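import Mathlib
import Summits.KontsevichZagierPeriods.Zeta5Search.Elimination.SignedDescent
import Summits.KontsevichZagierPeriods.Zeta5Search.Families.DualConstantTermCorner
import HarnessLib

/-!
# Boundary descent: CONJECTURE D-exact from the zero-slot boundary and ONE pencil family (fam-elim E-L30)

HONEST FRAMING: systematic search; no irrationality claim unless certified.  This file is bookkeeping about
identities between INTEGERS (Brown–Zudilin's leading coefficient `Q(a)` of (17), `BrownZudilin2022.QOf`, and the dual
constant term `dualConstantTerm a` of `Families/DualConstantTerm`); every node below is a HYPOTHESIS (a `Prop`
asserted nowhere); nothing is claimed about `ζ(5)`; records unmoved.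

## What is proved

Write `b(a) = (N; b₁,…,b₇)` for gen-1's dual coordinates (`bOfA`), "region" for `RegionHyp`, "cone" for
Brown–Zudilin's gap cone `DualCone` (`bzDen a ≥ 0`; on the region this is the six inequalities `b_j + b_k ≤ N` for the
non-`E` pairs `jk ∈ {16,17,27,35,45,46}`), and call a point a BOUNDARY point if some slot `b_m(a)`, `1 ≤ m ≤ 7`, is `0`
(`HasZeroSlot`).

1. **`signed_dexact_of_boundary`, `dexact_cone_of_boundary` (§2)** — CONJECTURE D-exact
   (`Families.Cellular.LeadingCoeffIsDualConstantTerm`, cert-2 / P2) on region ∩ cone follows from TWO nodes only: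
   `CTBoundaryAbs DualCone` (D-exact `|Q(a)| = CT(a)` at the BOUNDARY points of the cone) and E-L29's
   `CTPencilSlot DualCone s₀` (ONE pencil relation for `CT` per interior cone point, in one slot `s₀`).  The proof is
   E-L29's generic `regionDescent` with the STAR provider and the terminal provider both discharged by the boundary
   node (a STAR apex of the descent and a terminal point both have a zero slot), and E-L29's signed pencil step.
   Compared with E-L29's `dexact_cone_of_thin_abs` the STAR node `CTStarZero` (21 slot pairs) is GONE and the terminal
   node is replaced by the boundary node; `ctTerminalAbs_of_boundaryAbs` records that the boundary node contains the
   terminal one.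
2. **`dexact_cone_of_twoTerm` (the thin form, §5)** — the boundary node itself follows, by induction on the slot sum
   along the boundary with the PROVED corner identity `dexact_aCorner` as the only base, from two TWO-TERM laws: for
   `Q`, gen-1's STAR relation with the zero slot as pivot (`QTwoTermBoundary`: its middle point is a ghost point where
   (17) vanishes); for `CT`, the same first-order law with `|χ_iΠ_i|` (`CTTwoTermBoundary DualCone`).  So CONJECTURE
   D-exact on region ∩ cone ⟸ three THIN relation families (`QTwoTermBoundary`, `CTTwoTermBoundary DualCone`,
   `CTPencilSlot DualCone s₀`) and no value data at all (`ctBoundaryAbs_of_twoTerm`, `dexact_cone_of_twoTerm`).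
3. **The boundary closed form (CONJECTURE, internally minted; two nodes `QBoundaryForm`, `CTBoundaryForm`).**  At every
   boundary point of region ∩ cone both sides are ONE explicit multinomial quotient
   `BF(b) = ∏_{i=1..7} (N − b_i)! / ( N! · ∏_{j ∈ {1,4,5,6,7}} b_j! · ∏_{jk ∈ {16,17,27,35,45,46}} (N − b_j − b_k)! )`
   (`boundaryForm`): `|Q(a)| = BF(b(a)) = CT(a)`.  PROVED here only at the corners `(n; 0⁷)` (`boundaryForm_bCorner`,
   with the tree's `QOf_aCorner`, `dualConstantTerm_aCorner`) and on numerals; `dexact_cone_of_forms` assembles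
   D-exact on region ∩ cone from `QBoundaryForm`, `CTBoundaryForm` and `CTPencilSlot DualCone s₀`.
   Equivalent local form (the shape in which cert-2's torus certificates and gen-1's `StarW` enter): at a boundary
   point, for every slot `i` with `b_i ≥ 1`, the TWO-TERM law `b_i(N+1−b_i)·v(a) = |χ_iΠ_i(b)|·v(a − s_i)`
   (`fanCoeff`) for `v = |Q|` and `v = CT` — i.e. gen-1's STAR relation with the zero slot as pivot, whose third term
   `χ_kΠ_k·v(a − s_k)` is absent; `boundaryForm` is the unique solution with value `1` at the corners.

Evidence for the nodes (NOT used in any proof; exact rational arithmetic, stdlib, `HOME/pub-zeta5-fam-elim/g30/sanity/`):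
`|Q| = BF = CT` at all 9 476 boundary points of region ∩ cone of level `≤ 5` and `|Q| = BF` at 374 224 random boundary
points of levels `6…16` (`CT = BF` at 120 of levels `6…9`); the two-term law in every admissible direction at every
boundary point of level `≤ 5` (43 631 (point, direction) instances for `Q` and 43 631 for `CT`, no failure) and at NO
interior point (0 of the 4 928 instances at the 704 interior cone points of level `≤ 5`, all of which have
`|Q| = CT ≠ BF`): the interior is NOT covered by the closed form, there the pencil node does the work.  On the region,
`Q(a) = 0` exactly at the 1 650 points of level `≤ 5` outside the cone (E-L29).

[pub-zeta5 fam-elim gen 30; memo `HOME/pub-zeta5-fam-elim/g30/BOUNDARY-FORM.md`]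
-/

open Finset

namespace Summit.KontsevichZagierPeriods.Zeta5Search.Elimination

open Summit.KontsevichZagierPeriods.Zeta5Search.WedgeDictionary
open Summit.KontsevichZagierPeriods.Zeta5Search.Families.Cellular (dualConstantTerm bzNum bzDen
  dualConstantTerm_aCorner dexact_aCorner)
open Literature.NumberTheory.Irrationality.BrownZudilin2022 (bOfA Converges QOf pOf qOf)

/-! ## 1. The zero-slot boundary and the boundary node -/

/-- `a` is a BOUNDARY point: some dual slot `b_m(a)`, `1 ≤ m ≤ 7`, vanishes. -/
def HasZeroSlot (a : Fin 8 → ℤ) : Prop := ∃ i ∈ Icc 1 7, bOfA a i = 0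

/-- Terminal points `(N; x·𝟙_U)` are boundary points. -/
theorem hasZeroSlot_of_terminal {a : Fin 8 → ℤ} (h : Terminal a) : HasZeroSlot a := h.1

/-- **Boundary node (HYPOTHESIS; cert-2's unsigned vocabulary).**  CONJECTURE D-exact `|Q(a)| = CT(a)` at the boundary
region points of the guard `W` only. -/
def CTBoundaryAbs (W : (Fin 8 → ℤ) → Prop) : Prop :=
  ∀ (a : Fin 8 → ℤ) (j : ℕ), RegionHyp a j → W a → HasZeroSlot a → |QOf a| = dualConstantTerm a

/-- The boundary node contains E-L29's terminal node. -/
theorem ctTerminalAbs_of_boundaryAbs (W : (Fin 8 → ℤ) → Prop) (h : CTBoundaryAbs W) : CTTerminalAbs W :=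
  fun a j hr hW hT => h a j hr hW (hasZeroSlot_of_terminal hT)

/-! ## 2. The boundary descent -/

/-- **THE BOUNDARY DESCENT, signed form (PROVED).**  For a guard `W` closed on the region under the slot moves (at
slots `≥ 1`) and under `a ↦ a − DS` (at interior points), on which `Σp ≥ 0`: D-exact at the boundary points of `W`
and ONE pencil relation for `CT` per interior point of `W` give the SIGNED identity `Q(a) = qSign(a)·CT(a)` at every
region point of `W`.  (E-L29's `regionDescent`; its STAR apexes and terminal points have a zero slot, so both are read
off the boundary node; the pencil step is E-L29's, from `dictPencil_holds`.) -/
theorem signed_dexact_of_boundary (W : (Fin 8 → ℤ) → Prop)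
    (hWs : ∀ (a : Fin 8 → ℤ) (j k : ℕ), RegionHyp a j → k ∈ Icc 1 7 → 1 ≤ bOfA a k → W a → W (a + slotDown k))
    (hWd : ∀ (a : Fin 8 → ℤ) (j : ℕ), RegionHyp a j → (∀ m ∈ Icc 1 7, 1 ≤ bOfA a m) → W a → W (a - dsUp))
    (hsum : ∀ (a : Fin 8 → ℤ) (j : ℕ), RegionHyp a j → W a → 0 ≤ sumP a)
    {s₀ : ℕ} (hs₀ : s₀ ∈ Icc 1 7) (hB : CTBoundaryAbs W) (hP : CTPencilSlot W s₀) :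
    ∀ (a : Fin 8 → ℤ) (j : ℕ), RegionHyp a j → W a → QOf a = qSign a * dualConstantTerm a := by
  refine regionDescent (fun a => W a → QOf a = qSign a * dualConstantTerm a) ?_ ?_ ?_
  · -- STAR apexes have a zero slot: boundary node
    intro a j p q hr _ _ _ _ _ hzero _ _ hW
    rw [QOf_eq_qSign_mul_abs (hsum a j hr hW), hB a j hr hW hzero]
  · -- PENCIL step at slot `s₀` (E-L29)
    intro a j hr hpos hGb hGs hW
    have hca : a - dsUp + dsUp = a := sub_add_cancel a dsUp
    have hrb : RegionHyp (a - dsUp) j := regionHyp_sub_dsUp hr hpos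
    have hps := hpos s₀ hs₀
    have hrs : RegionHyp (a + slotDown s₀) j := regionHyp_slotDown hr hs₀ hps
    have hdic := dictPencil_holds (a - dsUp) s₀ j j j hs₀ hrb (by rw [hca]; exact hr) (by rw [hca]; exact hrs)
    rw [hca] at hdic
    obtain ⟨hQ0, -, -⟩ := hdic
    have hQ : (pencilBase (bOfA (a - dsUp)) : ℚ) * QOf (a - dsUp) + pencilApex (bOfA (a - dsUp)) s₀ * QOf a +
        fanCoeff (bOfA a) s₀ * QOf (a + slotDown s₀) = 0 := by
      linear_combination hQ0
    have hCT := hP a j hr hW hpos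
    have h₀ : QOf (a - dsUp) = qSign (a - dsUp) * dualConstantTerm (a - dsUp) := hGb (hWd a j hr hpos hW)
    have h₂ : QOf (a + slotDown s₀) = qSign (a + slotDown s₀) * dualConstantTerm (a + slotDown s₀) :=
      hGs s₀ hs₀ (hWs a j s₀ hr hs₀ hps hW)
    rw [qSign_sub_dsUp] at h₀
    rw [qSign_add_slotDown a hs₀] at h₂
    have hβ : (pencilApex (bOfA (a - dsUp)) s₀ : ℚ) ≠ 0 := by exact_mod_cast pencilApex_ne_zero hr hs₀ hps
    have hCT' : (pencilBase (bOfA (a - dsUp)) : ℚ) * dualConstantTerm (a - dsUp) -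
        pencilApex (bOfA (a - dsUp)) s₀ * dualConstantTerm a +
          fanCoeff (bOfA a) s₀ * dualConstantTerm (a + slotDown s₀) = 0 := by exact_mod_cast hCT
    have h₀' : (QOf (a - dsUp) : ℚ) = -(qSign a : ℚ) * dualConstantTerm (a - dsUp) := by exact_mod_cast h₀
    have h₂' : (QOf (a + slotDown s₀) : ℚ) = -(qSign a : ℚ) * dualConstantTerm (a + slotDown s₀) := by
      exact_mod_cast h₂
    have key : (pencilApex (bOfA (a - dsUp)) s₀ : ℚ) * ((QOf a : ℚ) - qSign a * dualConstantTerm a) = 0 := by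
      linear_combination hQ - (pencilBase (bOfA (a - dsUp)) : ℚ) * h₀' - (fanCoeff (bOfA a) s₀ : ℚ) * h₂' +
        (qSign a : ℚ) * hCT'
    have h0 := (mul_eq_zero.1 key).resolve_left hβ
    exact_mod_cast (sub_eq_zero.1 h0)
  · -- terminal points have a zero slot: boundary node
    intro a j hT hr _ hW
    rw [QOf_eq_qSign_mul_abs (hsum a j hr hW), hB a j hr hW (hasZeroSlot_of_terminal hT)]

/-- **D-exact from the boundary node and one pencil family, guarded form (PROVED).** -/
theorem dexact_of_boundary (W : (Fin 8 → ℤ) → Prop)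
    (hWs : ∀ (a : Fin 8 → ℤ) (j k : ℕ), RegionHyp a j → k ∈ Icc 1 7 → 1 ≤ bOfA a k → W a → W (a + slotDown k))
    (hWd : ∀ (a : Fin 8 → ℤ) (j : ℕ), RegionHyp a j → (∀ m ∈ Icc 1 7, 1 ≤ bOfA a m) → W a → W (a - dsUp))
    (hsum : ∀ (a : Fin 8 → ℤ) (j : ℕ), RegionHyp a j → W a → 0 ≤ sumP a)
    {s₀ : ℕ} (hs₀ : s₀ ∈ Icc 1 7) (hB : CTBoundaryAbs W) (hP : CTPencilSlot W s₀) :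
    ∀ (a : Fin 8 → ℤ) (j : ℕ), RegionHyp a j → W a → |QOf a| = dualConstantTerm a := by
  intro a j hr hW
  rw [signed_dexact_of_boundary W hWs hWd hsum hs₀ hB hP a j hr hW, abs_mul, abs_qSign, one_mul,
    abs_of_nonneg (dualConstantTerm_nonneg a)]

/-- **D-exact on gen-1's region ∩ Brown–Zudilin's cone from TWO nodes (PROVED): D-exact at the boundary cone points
(`CTBoundaryAbs DualCone`) and ONE pencil relation for `CT` per interior cone point (`CTPencilSlot DualCone s₀`).**
The cone is closed under the moves (`dualCone_add_slotDown`, `dualCone_sub_dsUp`) and carries `Σp ≥ 0`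
(`sumP_nonneg_of_cone`). -/
theorem dexact_cone_of_boundary {s₀ : ℕ} (hs₀ : s₀ ∈ Icc 1 7) (hB : CTBoundaryAbs DualCone)
    (hP : CTPencilSlot DualCone s₀) :
    ∀ (a : Fin 8 → ℤ) (j : ℕ), RegionHyp a j → (∀ i, 0 ≤ bzDen a i) → |QOf a| = dualConstantTerm a :=
  dexact_of_boundary DualCone (fun _ _ _ _ hk hpos h => dualCone_add_slotDown h hk hpos)
    (fun _ _ _ hpos h => dualCone_sub_dsUp h hpos) (fun _ _ hr hW => sumP_nonneg_of_cone hr hW) hs₀ hB hP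

/-- The signed form on region ∩ cone. -/
theorem signed_dexact_cone_of_boundary {s₀ : ℕ} (hs₀ : s₀ ∈ Icc 1 7) (hB : CTBoundaryAbs DualCone)
    (hP : CTPencilSlot DualCone s₀) :
    ∀ (a : Fin 8 → ℤ) (j : ℕ), RegionHyp a j → (∀ i, 0 ≤ bzDen a i) → QOf a = qSign a * dualConstantTerm a :=
  signed_dexact_of_boundary DualCone (fun _ _ _ _ hk hpos h => dualCone_add_slotDown h hk hpos)
    (fun _ _ _ hpos h => dualCone_sub_dsUp h hpos) (fun _ _ hr hW => sumP_nonneg_of_cone hr hW) hs₀ hB hP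

/-! ## 3. The boundary closed form (CONJECTURE nodes — asserted nowhere) -/

/-- The six NON-`E` slot pairs `{16,17,27,35,45,46}` (the complement of `WedgeDictionary.Epairs` among the 21 pairs; the
pairs of Brown–Zudilin's (35)). -/
def nonEPairs : List (ℕ × ℕ) := [(1, 6), (1, 7), (2, 7), (3, 5), (4, 5), (4, 6)]

/-- **The boundary closed form** `BF(b) = ∏_{i=1..7} (N − b_i)! / (N! · ∏_{j∈{1,4,5,6,7}} b_j! · ∏_{jk non-E} (N − b_j − b_k)!)`
(`N = b 0`; integer parts, the arguments are `≥ 0` on region ∩ cone). -/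
def boundaryForm (b : ℕ → ℤ) : ℚ :=
  (((List.range 7).map fun m => ((b 0 - b (m + 1)).toNat.factorial : ℚ)).prod) /
    (((b 0).toNat.factorial : ℚ) * (([1, 4, 5, 6, 7] : List ℕ).map fun j => ((b j).toNat.factorial : ℚ)).prod *
      (nonEPairs.map fun jk => ((b 0 - b jk.1 - b jk.2).toNat.factorial : ℚ)).prod)

/-- **CONJECTURE (boundary closed form, `Q` side; INTERNALLY MINTED — verified instances only).**  At every boundary
point of gen-1's region inside Brown–Zudilin's cone, `|Q(a)| = BF(b(a))`.  Evidence: the 9 476 boundary points of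
level `≤ 5` and 374 224 random boundary points of levels `6…16`, exact.  A proof route (memo §4): gen-1's gauge-free
STAR `Elimination.star_wedge` propagates the form along the boundary by induction on the slot sum (the two-term law is
its instance with the zero slot as pivot); the terminal families `(N; x·𝟙_U)` are, after `S₇`-transport
(`cas_permLower`), five sum-free instances of (17) (`|U| ≤ 5`, zeros at the slots `2,3`) and one Pfaff–Saalschütz
family (`|U| = 6`: `Σ_j C(x,j)C(m,j)C(m+j,j)C(m+x+j,x) = C(m+x,x)³`, `m = N − 2x`). -/
@[conjecture] def QBoundaryForm : Prop :=
  ∀ (a : Fin 8 → ℤ) (j : ℕ), RegionHyp a j → DualCone a → HasZeroSlot a → (|QOf a| : ℚ) = boundaryForm (bOfA a)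

/-- **CONJECTURE (boundary closed form, constant-term side; INTERNALLY MINTED — verified instances only).**  At every
boundary point of gen-1's region inside the cone, `CT(a) = BF(b(a))` — a closed-form evaluation of cert-2's threefold
binomial sum `DualCT.ctSum` when one of the seven dual slots vanishes.  Evidence: the 9 476 boundary points of level
`≤ 5` and 120 random ones of levels `6…9`, exact.  Equivalent local form: the two-term
laws `b_i(N+1−b_i)·CT(a) = |χ_iΠ_i(b)|·CT(a − s_i)` at boundary cone points (torus-side: first-order relations in
cert-2's translation/dilation module `DualConstantTermTranslations` / `…Dilations`). -/
@[conjecture] def CTBoundaryForm : Prop :=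
  ∀ (a : Fin 8 → ℤ) (j : ℕ), RegionHyp a j → DualCone a → HasZeroSlot a →
    (dualConstantTerm a : ℚ) = boundaryForm (bOfA a)

/-- The two closed-form nodes give the boundary node on the cone. -/
theorem ctBoundaryAbs_of_forms (hQ : QBoundaryForm) (hC : CTBoundaryForm) : CTBoundaryAbs DualCone := by
  intro a j hr hW hz
  have h : |(QOf a : ℚ)| = (dualConstantTerm a : ℚ) := by rw [hQ a j hr hW hz, hC a j hr hW hz]
  rw [← Int.cast_abs] at h
  exact_mod_cast h

/-- **CONJECTURE D-exact on region ∩ cone ⟸ the two boundary closed forms and ONE pencil family (PROVED implication;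
CONDITIONAL conclusion).** -/
theorem dexact_cone_of_forms {s₀ : ℕ} (hs₀ : s₀ ∈ Icc 1 7) (hQ : QBoundaryForm) (hC : CTBoundaryForm)
    (hP : CTPencilSlot DualCone s₀) :
    ∀ (a : Fin 8 → ℤ) (j : ℕ), RegionHyp a j → (∀ i, 0 ≤ bzDen a i) → |QOf a| = dualConstantTerm a :=
  dexact_cone_of_boundary hs₀ (ctBoundaryAbs_of_forms hQ hC) hP

/-! ## 4. Proved instances of the closed form -/

/-- At the corner `(n; 0⁷)` the closed form is `1`. -/
theorem boundaryForm_bCorner (n : ℕ) : boundaryForm (bCorner n) = 1 := by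
  have hf : n.factorial ≠ 0 := n.factorial_ne_zero
  simp [boundaryForm, bCorner, nonEPairs, List.range_succ, hf]

/-- The corners are boundary points. -/
theorem hasZeroSlot_aCorner (n : ℕ) : HasZeroSlot (aCorner n) :=
  ⟨1, by simp, by rw [bOfA_aCorner]; simp [bCorner]⟩

/-- **`QBoundaryForm` at the corners (PROVED):** `|Q(n,0,n,0,n,n,n,n)| = 1 = BF(n; 0⁷)` (`QOf_aCorner`). -/
theorem qBoundaryForm_aCorner (n : ℕ) : (|QOf (aCorner n)| : ℚ) = boundaryForm (bOfA (aCorner n)) := by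
  rw [bOfA_aCorner, boundaryForm_bCorner, QOf_aCorner]
  simp

/-- **`CTBoundaryForm` at the corners (PROVED):** `CT(n,0,n,0,n,n,n,n) = 1 = BF(n; 0⁷)` (cert-2's
`dualConstantTerm_aCorner`). -/
theorem ctBoundaryForm_aCorner (n : ℕ) : (dualConstantTerm (aCorner n) : ℚ) = boundaryForm (bOfA (aCorner n)) := by
  rw [bOfA_aCorner, boundaryForm_bCorner, dualConstantTerm_aCorner]
  simp

/-- Numerals: the single-slot value `BF(4; 2,0,0,0,0,0,0) = C(4,2) = 6`, a two-slot value
`BF(4; 2,0,0,0,0,2,0) = 4!/(2!²0!) = 6 = C(4,2)·C(2,2)` and a six-slot value `BF(3; 1,0,1,1,1,1,1) = C(2,1)⁵ = 32`. -/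
example : boundaryForm (fun j => if j = 0 then 4 else if j = 1 then 2 else 0) = 6 := by
  simp [boundaryForm, nonEPairs, List.range_succ]
  norm_num [Nat.factorial]

example : boundaryForm (fun j => if j = 0 then 4 else if j = 1 then 2 else if j = 6 then 2 else 0) = 6 := by
  simp [boundaryForm, nonEPairs, List.range_succ]
  norm_num [Nat.factorial]

example : boundaryForm (fun j => if j = 0 then 3 else if j = 2 then 0 else 1) = 32 := by
  simp [boundaryForm, nonEPairs, List.range_succ]
  norm_num [Nat.factorial]

/-! ## 5. Thin form of the boundary node: the two-term (zero-pivot STAR) laws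

At a boundary point the STAR relation of gen-1's `DictStar` for the slot pair `(i, m)` with `b_m = 0` reads
`b_i(N+1−b_i)·Q(a) − χ_mΠ_m·Q(a − s_m) + χ_iΠ_i·Q(a − s_i) = 0`, and its middle point `a − s_m` is a GHOST point
(`b_m = −1`) at which (17) is an empty or termwise-vanishing sum: `Q(a − s_m) = 0` (all 22 701 ghost points under the
boundary cone points of level `≤ 5`; the three-term form holds verbatim at all 92 484 `(a, i, m)` there).  What is left
is a TWO-TERM law relating `a` and `a − s_i` only.  The same two-term law for `CT` (with `|χ_iΠ_i|`, `CT ≥ 0`) is a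
first-order relation on cert-2's torus side.  From the two laws ALONE (no closed form, no terminal values except the
PROVED corner `dexact_aCorner`) the boundary node follows by induction on the slot sum. -/

/-- **CONJECTURE (boundary two-term law for `Q`; INTERNALLY MINTED — verified instances only).**  At a boundary point
of region ∩ cone, for every slot `i` with `b_i ≥ 1`:  `b_i(N+1−b_i)·Q(a) + χ_iΠ_i(b)·Q(a − s_i) = 0`
(`fanCoeff`; gen-1's STAR relation with the zero slot as pivot and vanishing ghost term).  Evidence: all 43 631
instances of level `≤ 5`, exact; it FAILS at every interior point (0 of 4 928 instances of level `≤ 5`). -/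
@[conjecture] def QTwoTermBoundary : Prop :=
  ∀ (a : Fin 8 → ℤ) (j i : ℕ), RegionHyp a j → DualCone a → HasZeroSlot a → i ∈ Icc 1 7 → 1 ≤ bOfA a i →
    bOfA a i * (bOfA a 0 + 1 - bOfA a i) * QOf a + fanCoeff (bOfA a) i * QOf (a + slotDown i) = 0

/-- **Two-term node for `CT` (HYPOTHESIS, guard `W`; cert-2's torus side).**  At a boundary region point of `W`, for
every slot `i` with `b_i ≥ 1`:  `b_i(N+1−b_i)·CT(a) = |χ_iΠ_i(b)|·CT(a − s_i)`.  Evidence on the cone: all 43 631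
instances of level `≤ 5`, exact. -/
def CTTwoTermBoundary (W : (Fin 8 → ℤ) → Prop) : Prop :=
  ∀ (a : Fin 8 → ℤ) (j i : ℕ), RegionHyp a j → W a → HasZeroSlot a → i ∈ Icc 1 7 → 1 ≤ bOfA a i →
    bOfA a i * (bOfA a 0 + 1 - bOfA a i) * dualConstantTerm a =
      |fanCoeff (bOfA a) i| * dualConstantTerm (a + slotDown i)

/-- A region point all of whose slots vanish is the corner `(N,0,N,0,N,N,N,N)` of its level. -/
theorem eq_aCorner_of_slots_zero {a : Fin 8 → ℤ} {j : ℕ} (hr : RegionHyp a j) (h0 : ∀ m ∈ Icc 1 7, bOfA a m = 0) :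
    a = aCorner (bOfA a 0).toNat := by
  have hN : ((bOfA a 0).toNat : ℤ) = bOfA a 0 := Int.toNat_of_nonneg (level_nonneg hr)
  have h1 := h0 1 (by simp)
  have h2 := h0 2 (by simp)
  have h3 := h0 3 (by simp)
  have h4 := h0 4 (by simp)
  have h5 := h0 5 (by simp)
  have h6 := h0 6 (by simp)
  have h7 := h0 7 (by simp)
  simp only [bOfA] at h1 h2 h3 h4 h5 h6 h7 hN
  ext n
  fin_cases n <;> simp [aCorner, bOfA] <;> omega

/-- D-exact at a region point all of whose slots vanish (cert-2's `dexact_aCorner`). -/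
theorem dexact_of_slots_zero {a : Fin 8 → ℤ} {j : ℕ} (hr : RegionHyp a j) (h0 : ∀ m ∈ Icc 1 7, bOfA a m = 0) :
    |QOf a| = dualConstantTerm a := by
  rw [eq_aCorner_of_slots_zero hr h0]
  exact dexact_aCorner _

/-- **The boundary node from the two two-term laws (PROVED; induction on the slot sum along the boundary of the
cone, base = the corners).** -/
theorem ctBoundaryAbs_of_twoTerm (hQ : QTwoTermBoundary) (hC : CTTwoTermBoundary DualCone) :
    CTBoundaryAbs DualCone := by
  suffices H : ∀ (s : ℕ) (a : Fin 8 → ℤ) (j : ℕ), RegionHyp a j → DualCone a → HasZeroSlot a →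
      (slotSum a).toNat = s → |QOf a| = dualConstantTerm a from fun a j hr hW hz => H _ a j hr hW hz rfl
  intro s
  induction s using Nat.strong_induction_on with
  | _ s ih =>
    intro a j hr hW hz hs
    by_cases h0 : ∀ m ∈ Icc 1 7, bOfA a m = 0
    · exact dexact_of_slots_zero hr h0
    · push Not at h0
      obtain ⟨i, hi, hne⟩ := h0
      have hbox := hr.2.2.1
      have hbi := hbox i hi
      have hpos : 1 ≤ bOfA a i := by omega
      have hi7 : i ≤ 7 := (mem_Icc.1 hi).2
      obtain ⟨m, hm, hm0⟩ := hz
      have hmi : m ≠ i := by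
        rintro rfl
        omega
      have hz' : HasZeroSlot (a + slotDown i) :=
        ⟨m, hm, by rw [bOfA_add_slotDown a i hi m (mem_Icc.1 hm).2, if_neg hmi]; exact hm0⟩
      have hr' : RegionHyp (a + slotDown i) j := regionHyp_slotDown hr hi hpos
      have hW' : DualCone (a + slotDown i) := dualCone_add_slotDown hW hi hpos
      have hge : bOfA a i ≤ slotSum a := le_slotSum hr hi
      have hlt : (slotSum (a + slotDown i)).toNat < s := by
        rw [slotSum_add_slotDown a hi]
        omega
      have ih' : |QOf (a + slotDown i)| = dualConstantTerm (a + slotDown i) :=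
        ih _ hlt (a + slotDown i) j hr' hW' hz' rfl
      have h1 := hQ a j i hr hW ⟨m, hm, hm0⟩ hi hpos
      have h2 := hC a j i hr hW ⟨m, hm, hm0⟩ hi hpos
      have hb : 0 < bOfA a i := by omega
      have hb' : 0 < bOfA a 0 + 1 - bOfA a i := by omega
      have hc : 0 < bOfA a i * (bOfA a 0 + 1 - bOfA a i) := mul_pos hb hb'
      have h1' : bOfA a i * (bOfA a 0 + 1 - bOfA a i) * QOf a = -(fanCoeff (bOfA a) i * QOf (a + slotDown i)) := by
        linear_combination h1
      have h3 : bOfA a i * (bOfA a 0 + 1 - bOfA a i) * |QOf a| =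
          |fanCoeff (bOfA a) i| * |QOf (a + slotDown i)| := by
        have h4 := congrArg (fun x : ℤ => |x|) h1'
        simp only [abs_mul, abs_neg] at h4
        rwa [abs_of_pos hb, abs_of_pos hb'] at h4
      rw [ih', ← h2] at h3
      exact mul_left_cancel₀ hc.ne' h3

/-- **CONJECTURE D-exact on region ∩ cone from THREE THIN RELATION FAMILIES (PROVED implication; CONDITIONAL
conclusion):** the boundary two-term laws for `Q` (`QTwoTermBoundary`, gen-1's zero-pivot STAR) and for `CT`
(`CTTwoTermBoundary DualCone`), and ONE pencil relation for `CT` per interior cone point (`CTPencilSlot DualCone s₀`).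
No terminal value enters except the PROVED corner identity `dexact_aCorner`. -/
theorem dexact_cone_of_twoTerm {s₀ : ℕ} (hs₀ : s₀ ∈ Icc 1 7) (hQ : QTwoTermBoundary)
    (hC : CTTwoTermBoundary DualCone) (hP : CTPencilSlot DualCone s₀) :
    ∀ (a : Fin 8 → ℤ) (j : ℕ), RegionHyp a j → (∀ i, 0 ≤ bzDen a i) → |QOf a| = dualConstantTerm a :=
  dexact_cone_of_boundary hs₀ (ctBoundaryAbs_of_twoTerm hQ hC) hP

end Summit.KontsevichZagierPeriods.Zeta5Search.Elimination
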